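import Literature.NumberTheory.Sieve.MoebiusShiftedPrimesSieveBound
import Literature.NumberTheory.Sieve.SieveFrameworkFundamentalLemma
import Literature.NumberTheory.Sieve.BoundedClassDensitySieveDimension
import HarnessLib

/-!
# The fundamental lemma for an interval sifted by prescribed residue classes

Topic `Literature/NumberTheory/Sieve`.  Fully proved, no definition and no new fact: for every
`D : ℕ` there is `C = C(D) > 0` such that for every length `X : ℕ`, every choice of residue classes
`Ω p ⊆ {0, …, p − 1}` with `#Ω p ≤ D` and `#Ω p < p` at every prime `p`, and all `2 ≤ z ≤ L`,

  `|#{1 ≤ n ≤ X : n mod p ∉ Ω p for every prime p < z} − X·V(z)| ≤ C·X·V(z)·e^{−log L/log z} + L²`,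
  `V(z) = ∏_{p < z} (1 − #Ω p/p)`

(`IntervalClassSieve.abs_card_sub_le`), together with the lower bound
`V(z) ≥ c(D)/(log z)^{2D}` (`IntervalClassSieve.le_prod_one_sub_card_div`).  This is the classical
"sieve of an interval by `≤ D` classes per prime" (Halberstam–Richert, *Sieve Methods*, Ch. 2,
Thm 2.5 with their Example 1 / (Ω₁), (R); Friedlander–Iwaniec, *Opera de Cribro*, Cor. 6.10), obtained
here from the tree's PROVED uniform Fundamental Lemma
`SieveSequence.fundamental_lemma_uniform_holds` (`SieveFrameworkFundamentalLemma.lean`).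

## The argument (sub-namespace `IntervalClassSieve`)

Exactly the bookkeeping of `MoebiusShiftedPrimesSieveBound.lean` (namespace `Lichtman2020`, whose
Chinese-remainder count `card_filter_range_prod_eq_prod_card` is reused) for general classes:

* encode `n ↦ N(n) = ∏_{p < z, n mod p ∈ Ω p} p` (`prime_dvd_classProd_iff`: a prime `q` divides
  `N(n)` iff `q < z` and `n mod q ∈ Ω q`), and sift the VALUES `N(n)`, `1 ≤ n ≤ X`, by the primes
  `< z`: weights `a_m = #{n ≤ X : N(n) = m}`, size `X`, multiplicative density
  `g(d) = ∏_{p ∣ d} #Ω p/p` (`BoundedClassDensity.isMultiplicative_of_apply_eq_prod`);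
* dictionary (`sum_a_filter_eq`, `congrSum_eq`, `sifted_eq`, `densityProduct_eq`):
  `S(𝒜, P(z)) = #{n ≤ X : n mod p ∉ Ω p ∀ p < z}`, `V(P(z)) = ∏_{p<z}(1 − #Ω p/p)`;
* level (`abs_remainder_le`): for squarefree `d` with prime factors `< z` the condition `d ∣ N(n)`
  is `d`-periodic with `∏_{p ∣ d} #Ω p` admissible residues (CRT), so `|R_d| ≤ ∏ #Ω p ≤ d`
  (`BrunTwinPrimes.abs_card_filter_Icc_sub_le`), and `∑_{d ∣ P(z), d ≤ L} |R_d| ≤ L²`;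
* dimension: `g` has dimension `2D` with a constant `K_D` depending on `D` only
  (`BoundedClassDensity.hasSieveDimension_of_card_le`, file `BoundedClassDensitySieveDimension.lean`);
  with `w = 2` the same condition gives the lower bound for `V(z)`.

The sifted sequence is built inside the proofs (anonymous structure); the dictionary lemmas are
stated for an abstract `SieveSequence` / encoding described by hypotheses, so that the file
introduces no definition (contrast the `def`-based `Lichtman2020.seq`, `PairLinearSieve.seq`).  First client: the two-sided fundamental lemma along a Bateman–Horn
system with staggered sifting thresholds (`Summits/Parity/BatemanHorn`, route `RoughValueTransport`,
crux `RoughValueLaw`), where `Ω p` is the set of roots of those `fᵢ` whose threshold exceeds `p`.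

## References

* H. Halberstam, H.-E. Richert, *Sieve Methods* (1974), Ch. 1 (Examples 1, 3), Thm 2.5.
  [HalberstamRichert1974]
* J. Friedlander, H. Iwaniec, *Opera de Cribro* (2010), Lemma 6.8, Thm 6.9, Cor. 6.10.
  [FriedlanderIwaniecOpera2010]
-/

noncomputable section

open Finset

namespace Literature.NumberTheory.Sieve

namespace IntervalClassSieve

open Lichtman2020 (card_filter_range_prod_eq_prod_card)
open BoundedClassDensity (isMultiplicative_of_apply_eq_prod hasSieveDimension_of_card_le)

/-! ### The encoding `N(n) = ∏_{p < M, n mod p ∈ Ω p} p` -/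

/-- A prime `q` divides `N(n) = ∏_{p < M prime, n mod p ∈ Ω p} p` iff `q < M` and
`n mod q ∈ Ω q` (a product of distinct primes). [folklore] -/
theorem prime_dvd_classProd_iff (Ω : ℕ → Finset ℕ) (M n : ℕ) {q : ℕ} (hq : q.Prime) :
    q ∣ ∏ p ∈ (Nat.primesBelow M).filter (fun p => n % p ∈ Ω p), p ↔ q < M ∧ n % q ∈ Ω q := by
  rw [Prime.dvd_finsetProd_iff hq.prime _]
  constructor
  · rintro ⟨p, hp, hqp⟩
    rw [Finset.mem_filter, Nat.mem_primesBelow] at hp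
    obtain rfl := (Nat.prime_dvd_prime_iff_eq hq hp.1.2).mp hqp
    exact ⟨hp.1.1, hp.2⟩
  · rintro ⟨hM, hmem⟩
    exact ⟨q, Finset.mem_filter.mpr ⟨Nat.mem_primesBelow.mpr ⟨hM, hq⟩, hmem⟩, dvd_rfl⟩

/-- `N(n) > 0`. [folklore] -/
theorem classProd_pos (Ω : ℕ → Finset ℕ) (M n : ℕ) :
    0 < ∏ p ∈ (Nat.primesBelow M).filter (fun p => n % p ∈ Ω p), p :=
  Finset.prod_pos fun _ hp => (Nat.prime_of_mem_primesBelow (Finset.mem_filter.mp hp).1).pos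

/-- `N(n) ≤ ∏_{p < M} p`. [folklore] -/
theorem classProd_le (Ω : ℕ → Finset ℕ) (M n : ℕ) :
    ∏ p ∈ (Nat.primesBelow M).filter (fun p => n % p ∈ Ω p), p ≤ ∏ p ∈ Nat.primesBelow M, p :=
  Nat.le_of_dvd (Finset.prod_pos fun _ hp => (Nat.prime_of_mem_primesBelow hp).pos)
    (Finset.prod_dvd_prod_of_subset _ _ _ (Finset.filter_subset _ _))

/-- For an encoding `N` with `q ∣ N(n) ↔ q < M ∧ n mod q ∈ Ω q` at primes `q` and a squarefree `d`:
`d ∣ N(n)` iff every prime `q ∣ d` has `q < M` and `n mod q ∈ Ω q`. [folklore] -/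
theorem dvd_iff_forall_primeFactors {N : ℕ → ℕ} {M : ℕ} {Ω : ℕ → Finset ℕ}
    (hN : ∀ n q : ℕ, q.Prime → (q ∣ N n ↔ q < M ∧ n % q ∈ Ω q)) {d : ℕ} (hd : Squarefree d)
    (n : ℕ) : d ∣ N n ↔ ∀ q ∈ d.primeFactors, q < M ∧ n % q ∈ Ω q := by
  constructor
  · intro hdvd q hq
    exact (hN n q (Nat.prime_of_mem_primeFactors hq)).mp ((Nat.dvd_of_mem_primeFactors hq).trans hdvd)
  · intro H
    rw [← Nat.prod_primeFactors_of_squarefree hd]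
    exact Finset.prod_primes_dvd _ (fun q hq => (Nat.prime_of_mem_primeFactors hq).prime)
      (fun q hq => (hN n q (Nat.prime_of_mem_primeFactors hq)).mpr (H q hq))

/-! ### The sifted sequence of the values `N(n)`, `1 ≤ n ≤ X`: dictionary -/

/-- Fibre count: if `a_m = #{n ≤ X : N(n) = m}` and `0 < N ≤ B`, then summing the weights over the
`m ≤ B` with `C m` counts the `n ≤ X` with `C (N n)`. [folklore] -/
theorem sum_a_filter_eq {A : SieveSequence} {X B : ℕ} {N : ℕ → ℕ}
    (ha : ∀ m, A.a m = (#{n ∈ Icc 1 X | N n = m} : ℝ)) (hN0 : ∀ n, 0 < N n)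
    (hNB : ∀ n, N n ≤ B) (C : ℕ → Prop) [DecidablePred C] :
    ∑ m ∈ (Ioc 0 B).filter C, A.a m = #{n ∈ Icc 1 X | C (N n)} := by
  simp only [ha]
  rw [← Nat.cast_sum, Nat.cast_inj]
  rw [Finset.card_eq_sum_card_fiberwise (f := N) (s := {n ∈ Icc 1 X | C (N n)})
    (t := (Ioc 0 B).filter C) ?_]
  · refine Finset.sum_congr rfl fun m hm => ?_
    have hCm : C m := (Finset.mem_filter.mp hm).2
    congr 1
    ext n
    simp only [Finset.mem_filter]
    constructor
    · rintro ⟨h1, h3⟩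
      exact ⟨⟨h1, by rw [h3]; exact hCm⟩, h3⟩
    · rintro ⟨⟨h1, _⟩, h3⟩
      exact ⟨h1, h3⟩
  · intro n hn
    have hn' : n ∈ {n ∈ Icc 1 X | C (N n)} := hn
    rw [Finset.mem_filter] at hn'
    show N n ∈ (Ioc 0 B).filter C
    rw [Finset.mem_filter, Finset.mem_Ioc]
    exact ⟨⟨hN0 n, hNB n⟩, hn'.2⟩

/-- The congruence sums count the `n ≤ X` with `d ∣ N(n)`. [folklore] -/
theorem congrSum_eq {A : SieveSequence} {X B : ℕ} {N : ℕ → ℕ}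
    (ha : ∀ m, A.a m = (#{n ∈ Icc 1 X | N n = m} : ℝ)) (hN0 : ∀ n, 0 < N n)
    (hNB : ∀ n, N n ≤ B) (d : ℕ) : A.congrSum d B = #{n ∈ Icc 1 X | d ∣ N n} := by
  rw [SieveSequence.congrSum, Nat.floor_natCast]
  exact sum_a_filter_eq ha hN0 hNB (d ∣ ·)

/-- The sifting function counts the `n ≤ X` with `(N(n), P) = 1`. [folklore] -/
theorem sifted_eq {A : SieveSequence} {X B : ℕ} {N : ℕ → ℕ}
    (ha : ∀ m, A.a m = (#{n ∈ Icc 1 X | N n = m} : ℝ)) (hN0 : ∀ n, 0 < N n)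
    (hNB : ∀ n, N n ≤ B) (P : ℕ) : A.sifted B P = #{n ∈ Icc 1 X | (N n).Coprime P} := by
  rw [SieveSequence.sifted, Nat.floor_natCast]
  exact sum_a_filter_eq ha hN0 hNB (fun m => m.Coprime P)

/-- `V(P(z)) = ∏_{p < z} (1 − #Ω p/p)` for a density with `g(d) = ∏_{p ∣ d} #Ω p/p`. [folklore] -/
theorem densityProduct_eq {A : SieveSequence} {Ω : ℕ → Finset ℕ}
    (hdens : ∀ d : ℕ, d ≠ 0 → A.density d = ∏ p ∈ d.primeFactors, (#(Ω p) : ℝ) / p) (z : ℝ) :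
    A.densityProduct (primesProdBelow z) =
      ∏ p ∈ Nat.primesBelow ⌈z⌉₊, (1 - (#(Ω p) : ℝ) / p) := by
  rw [SieveSequence.densityProduct, primeFactors_primesProdBelow]
  refine Finset.prod_congr rfl fun p hp => ?_
  have hpp := Nat.prime_of_mem_primesBelow hp
  rw [hdens p hpp.ne_zero, hpp.primeFactors, Finset.prod_singleton]

/-- **Level of distribution**: for squarefree `d` all of whose prime factors are `< M`,
`|R_d| ≤ ∏_{p ∣ d} #Ω p ≤ d`, by periodicity modulo `d` of `d ∣ N(n)` and the Chinese remainder
count (Halberstam–Richert Ch. 1, Example 1 / condition (R)). [folklore] -/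
theorem abs_remainder_le {A : SieveSequence} {X B M : ℕ} {N : ℕ → ℕ} {Ω : ℕ → Finset ℕ}
    (ha : ∀ m, A.a m = (#{n ∈ Icc 1 X | N n = m} : ℝ)) (hN0 : ∀ n, 0 < N n)
    (hNB : ∀ n, N n ≤ B) (hsize : ∀ t, A.size t = X)
    (hdens : ∀ d : ℕ, d ≠ 0 → A.density d = ∏ p ∈ d.primeFactors, (#(Ω p) : ℝ) / p)
    (hΩ : ∀ p : ℕ, p.Prime → ∀ r ∈ Ω p, r < p)
    (hN : ∀ n q : ℕ, q.Prime → (q ∣ N n ↔ q < M ∧ n % q ∈ Ω q))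
    {d : ℕ} (hd : Squarefree d) (hdM : ∀ q ∈ d.primeFactors, q < M) :
    |A.remainder d B| ≤ d := by
  have hd0 : 0 < d := Nat.pos_of_ne_zero hd.ne_zero
  set cond : ℕ → Prop := fun n => ∀ q ∈ d.primeFactors, n % q ∈ Ω q with hcond
  have hfilter : {n ∈ Icc 1 X | d ∣ N n} = {n ∈ Icc 1 X | cond n} := by
    refine Finset.filter_congr fun n _ => ?_
    rw [dvd_iff_forall_primeFactors hN hd]
    exact forall₂_congr fun q hq => and_iff_right (hdM q hq)
  have hper : Function.Periodic cond d := by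
    intro n
    simp only [hcond, eq_iff_iff]
    refine forall₂_congr fun q hq => ?_
    obtain ⟨k, hk⟩ := Nat.dvd_of_mem_primeFactors hq
    rw [show (n + d) % q = n % q by rw [hk, Nat.add_mul_mod_self_left]]
  have hcount : Nat.count cond d = ∏ q ∈ d.primeFactors, #(Ω q) := by
    rw [Nat.count_eq_card_filter_range]
    have := card_filter_range_prod_eq_prod_card d.primeFactors
      (fun q hq => Nat.prime_of_mem_primeFactors hq) Ω
      (fun q hq => hΩ q (Nat.prime_of_mem_primeFactors hq))
    rw [Nat.prod_primeFactors_of_squarefree hd] at this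
    exact this
  have hcle : Nat.count cond d ≤ d := Nat.count_le _
  have hmain := BrunTwinPrimes.abs_card_filter_Icc_sub_le hd0 cond hper X
  have hdcast : (d : ℝ) = ∏ q ∈ d.primeFactors, (q : ℝ) := by
    rw [← Nat.cast_prod, Nat.prod_primeFactors_of_squarefree hd]
  have hdens' : A.density d * A.size B = (X : ℝ) * (Nat.count cond d : ℝ) / d := by
    rw [hsize, hdens d hd.ne_zero, Finset.prod_div_distrib, ← hdcast, hcount]
    push_cast
    ring
  rw [SieveSequence.remainder, congrSum_eq ha hN0 hNB, hfilter, hdens']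
  have hcle' : (Nat.count cond d : ℝ) ≤ d := by exact_mod_cast hcle
  exact hmain.trans hcle'

/-! ### The fundamental lemma for the interval -/

/-- **The fundamental lemma for an interval sifted by prescribed residue classes.**  For every `D`
there is `C = C(D) > 0` such that for every `X : ℕ`, all classes `Ω p ⊆ {0, …, p − 1}` with
`#Ω p ≤ D` and `#Ω p < p` at every prime `p`, and all `2 ≤ z ≤ L`:
`|#{1 ≤ n ≤ X : n mod p ∉ Ω p ∀ p < z} − X V(z)| ≤ C X V(z) e^{−log L/log z} + L²`,
`V(z) = ∏_{p<z} (1 − #Ω p/p)` (Halberstam–Richert Thm 2.5 for the sequence of Example 1;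
Friedlander–Iwaniec Cor. 6.10), from the tree's PROVED uniform Fundamental Lemma applied to the values
`N(n) = ∏_{p<z, n mod p ∈ Ω p} p` (dimension `2D`, `|R_d| ≤ d`). [folklore] -/
theorem abs_card_sub_le (D : ℕ) :
    ∃ C : ℝ, 0 < C ∧ ∀ (X : ℕ) (Ω : ℕ → Finset ℕ),
      (∀ p : ℕ, p.Prime → ∀ r ∈ Ω p, r < p) → (∀ p : ℕ, p.Prime → #(Ω p) ≤ D) →
      (∀ p : ℕ, p.Prime → #(Ω p) < p) →
      ∀ z L : ℝ, 2 ≤ z → z ≤ L →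
        |(#{n ∈ Icc 1 X | ∀ p ∈ Nat.primesBelow ⌈z⌉₊, n % p ∉ Ω p} : ℝ) -
            X * ∏ p ∈ Nat.primesBelow ⌈z⌉₊, (1 - (#(Ω p) : ℝ) / p)| ≤
          C * X * (∏ p ∈ Nat.primesBelow ⌈z⌉₊, (1 - (#(Ω p) : ℝ) / p)) *
              Real.exp (-(Real.log L / Real.log z)) + L ^ 2 := by
  obtain ⟨C, hC, hFL⟩ := SieveSequence.fundamental_lemma_uniform_holds (2 * D)
    (((2 * D + 1 : ℕ) : ℝ) ^ (2 * D + 1) * Real.exp (2 * D * (9 / 2 + 6 / Real.log 2)))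
  refine ⟨C, hC, fun X Ω hΩ hle hlt z L hz hzL => ?_⟩
  -- the encoding, the density and the sequence
  obtain ⟨M, hM⟩ : ∃ M : ℕ, M = ⌈z⌉₊ := ⟨_, rfl⟩
  obtain ⟨N, hN, hN0, hNB⟩ : ∃ N : ℕ → ℕ, (∀ n q : ℕ, q.Prime → (q ∣ N n ↔ q < M ∧ n % q ∈ Ω q)) ∧
      (∀ n, 0 < N n) ∧ ∀ n, N n ≤ ∏ p ∈ Nat.primesBelow M, p :=
    ⟨fun n => ∏ p ∈ (Nat.primesBelow M).filter (fun p => n % p ∈ Ω p), p,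
      fun n q hq => prime_dvd_classProd_iff Ω M n hq, fun n => classProd_pos Ω M n,
      fun n => classProd_le Ω M n⟩
  obtain ⟨g, hg⟩ : ∃ g : ArithmeticFunction ℝ,
      ∀ d : ℕ, d ≠ 0 → g d = ∏ p ∈ d.primeFactors, (#(Ω p) : ℝ) / p :=
    ⟨⟨fun d => if d = 0 then 0 else ∏ p ∈ d.primeFactors, (#(Ω p) : ℝ) / p, if_pos rfl⟩,
      fun d hd => if_neg hd⟩
  have hgp : ∀ p : ℕ, p.Prime → g p = ((#(Ω p) : ℕ) : ℝ) / p := fun p hp => by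
    rw [hg p hp.ne_zero, hp.primeFactors, Finset.prod_singleton]
  have hdim := hasSieveDimension_of_card_le hgp hle hlt
  obtain ⟨A, ha, hsize, hdens⟩ : ∃ A : SieveSequence, (∀ m, A.a m = (#{n ∈ Icc 1 X | N n = m} : ℝ)) ∧
      (∀ t, A.size t = X) ∧ ∀ d : ℕ, d ≠ 0 → A.density d = ∏ p ∈ d.primeFactors, (#(Ω p) : ℝ) / p :=
    ⟨⟨fun m => (#{n ∈ Icc 1 X | N n = m} : ℝ), fun _ => Nat.cast_nonneg _, fun _ => (X : ℝ), g,
      isMultiplicative_of_apply_eq_prod hg⟩, fun _ => rfl, fun _ => rfl, hg⟩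
  have hdimA : HasSieveDimension A.density (2 * D)
      (((2 * D + 1 : ℕ) : ℝ) ^ (2 * D + 1) * Real.exp (2 * D * (9 / 2 + 6 / Real.log 2))) := by
    refine ⟨fun p hp => ?_, fun w z' hw hwz => ?_⟩
    · rw [hdens p hp.ne_zero, ← hg p hp.ne_zero]; exact hdim.1 p hp
    · refine le_of_eq_of_le (Finset.prod_congr rfl fun p hp => ?_) (hdim.2 w z' hw hwz)
      have hpp := Nat.prime_of_mem_primesBelow (Finset.mem_filter.mp hp).1
      rw [hdens p hpp.ne_zero, ← hg p hpp.ne_zero]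
  set B : ℕ := ∏ p ∈ Nat.primesBelow M, p with hB
  have h := hFL A hdimA (B : ℝ) z L hz hzL (by rw [hsize]; exact Nat.cast_nonneg _)
  -- identify the sifting function and the main term
  have hS : A.sifted B (primesProdBelow z) =
      #{n ∈ Icc 1 X | ∀ p ∈ Nat.primesBelow ⌈z⌉₊, n % p ∉ Ω p} := by
    have hset : {n ∈ Icc 1 X | (N n).Coprime (primesProdBelow z)} =
        {n ∈ Icc 1 X | ∀ p ∈ Nat.primesBelow ⌈z⌉₊, n % p ∉ Ω p} := by
      refine Finset.filter_congr fun n _ => ?_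
      rw [coprime_primesProdBelow_iff]
      refine forall₂_congr fun q hq => ?_
      rw [Nat.mem_primesBelow] at hq
      rw [hN n q hq.2, hM]
      exact ⟨fun h1 h2 => h1 ⟨hq.1, h2⟩, fun h1 h2 => h1 h2.2⟩
    rw [sifted_eq ha hN0 hNB, hset]
  have hV : A.densityProduct (primesProdBelow z) =
      ∏ p ∈ Nat.primesBelow ⌈z⌉₊, (1 - (#(Ω p) : ℝ) / p) := densityProduct_eq hdens z
  -- the remainder sum
  have hL0 : 0 ≤ L := by linarith
  have hR : ∑ d ∈ (primesProdBelow z).divisors.filter (fun d : ℕ => (d : ℝ) ≤ L),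
      |A.remainder d B| ≤ L ^ 2 := by
    have h1 : ∀ d ∈ (primesProdBelow z).divisors.filter (fun d : ℕ => (d : ℝ) ≤ L),
        |A.remainder d B| ≤ L := by
      intro d hd
      rw [Finset.mem_filter, Nat.mem_divisors] at hd
      have hsq : Squarefree d := (squarefree_primesProdBelow z).squarefree_of_dvd hd.1.1
      have hdM : ∀ q ∈ d.primeFactors, q < M := fun q hq => by
        rw [hM]
        exact Nat.lt_ceil.mpr ((dvd_primesProdBelow_iff (Nat.prime_of_mem_primeFactors hq) z).mp
          ((Nat.dvd_of_mem_primeFactors hq).trans hd.1.1))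
      exact (abs_remainder_le ha hN0 hNB hsize hdens hΩ hN hsq hdM).trans hd.2
    have h2 : (#((primesProdBelow z).divisors.filter (fun d : ℕ => (d : ℝ) ≤ L)) : ℝ) ≤ L := by
      have hsub : (primesProdBelow z).divisors.filter (fun d : ℕ => (d : ℝ) ≤ L) ⊆
          Icc 1 ⌊L⌋₊ := by
        intro d hd
        rw [Finset.mem_filter, Nat.mem_divisors] at hd
        rw [Finset.mem_Icc]
        exact ⟨Nat.pos_of_dvd_of_pos hd.1.1 (Nat.pos_of_ne_zero hd.1.2), Nat.le_floor hd.2⟩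
      calc (#((primesProdBelow z).divisors.filter (fun d : ℕ => (d : ℝ) ≤ L)) : ℝ)
          ≤ #(Icc 1 ⌊L⌋₊) := by exact_mod_cast Finset.card_le_card hsub
        _ = ((⌊L⌋₊ : ℕ) : ℝ) := by rw [Nat.card_Icc, Nat.add_sub_cancel]
        _ ≤ L := Nat.floor_le hL0
    calc ∑ d ∈ (primesProdBelow z).divisors.filter (fun d : ℕ => (d : ℝ) ≤ L), |A.remainder d B|
        ≤ #((primesProdBelow z).divisors.filter (fun d : ℕ => (d : ℝ) ≤ L)) • L :=
          Finset.sum_le_card_nsmul _ _ _ h1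
      _ = (#((primesProdBelow z).divisors.filter (fun d : ℕ => (d : ℝ) ≤ L)) : ℝ) * L := by
          rw [nsmul_eq_mul]
      _ ≤ L * L := mul_le_mul_of_nonneg_right h2 hL0
      _ = L ^ 2 := (sq L).symm
  rw [hS, hsize, hV] at h
  linarith

/-- **Lower bound for the main term.**  For every `D` there is `c = c(D) > 0` with
`∏_{p < z} (1 − #Ω p/p) ≥ c/(log z)^{2D}` for all `z ≥ 2`, whenever `#Ω p ≤ D` and `#Ω p < p` at
every prime (the dimension condition with `w = 2`; `c = (log 2)^{2D}/K_D`). [folklore] -/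
theorem le_prod_one_sub_card_div (D : ℕ) :
    ∃ c : ℝ, 0 < c ∧ ∀ (Ω : ℕ → Finset ℕ), (∀ p : ℕ, p.Prime → #(Ω p) ≤ D) →
      (∀ p : ℕ, p.Prime → #(Ω p) < p) → ∀ z : ℝ, 2 ≤ z →
        c / Real.log z ^ (2 * D) ≤ ∏ p ∈ Nat.primesBelow ⌈z⌉₊, (1 - (#(Ω p) : ℝ) / p) := by
  set K : ℝ := ((2 * D + 1 : ℕ) : ℝ) ^ (2 * D + 1) * Real.exp (2 * D * (9 / 2 + 6 / Real.log 2))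
    with hK
  have hK0 : 0 < K := by positivity
  have hlog2 : 0 < Real.log 2 := Real.log_pos one_lt_two
  refine ⟨Real.log 2 ^ (2 * D) / K, by positivity, fun Ω hle hlt z hz => ?_⟩
  obtain ⟨g, hg⟩ : ∃ g : ArithmeticFunction ℝ,
      ∀ d : ℕ, d ≠ 0 → g d = ∏ p ∈ d.primeFactors, (#(Ω p) : ℝ) / p :=
    ⟨⟨fun d => if d = 0 then 0 else ∏ p ∈ d.primeFactors, (#(Ω p) : ℝ) / p, if_pos rfl⟩,
      fun d hd => if_neg hd⟩
  have hgp : ∀ p : ℕ, p.Prime → g p = ((#(Ω p) : ℕ) : ℝ) / p := fun p hp => by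
    rw [hg p hp.ne_zero, hp.primeFactors, Finset.prod_singleton]
  have hdim := hasSieveDimension_of_card_le hgp hle hlt
  have h2 := hdim.2 2 z le_rfl hz
  have hfilter : (Nat.primesBelow ⌈z⌉₊).filter (fun p : ℕ => (2 : ℝ) ≤ (p : ℝ)) =
      Nat.primesBelow ⌈z⌉₊ :=
    Finset.filter_true_of_mem fun p hp => by
      exact_mod_cast (Nat.prime_of_mem_primesBelow hp).two_le
  rw [hfilter, Finset.prod_inv_distrib, ← hK] at h2
  have hVeq : ∏ p ∈ Nat.primesBelow ⌈z⌉₊, (1 - g p) =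
      ∏ p ∈ Nat.primesBelow ⌈z⌉₊, (1 - (#(Ω p) : ℝ) / p) :=
    Finset.prod_congr rfl fun p hp => by rw [hgp p (Nat.prime_of_mem_primesBelow hp)]
  have hVpos : 0 < ∏ p ∈ Nat.primesBelow ⌈z⌉₊, (1 - g p) :=
    Finset.prod_pos fun p hp => sub_pos.mpr (hdim.1 p (Nat.prime_of_mem_primesBelow hp)).2
  have hlogz : 0 < Real.log z := Real.log_pos (by linarith)
  have h3 : (K * (Real.log z / Real.log 2) ^ (2 * (D : ℝ)))⁻¹ ≤
      ∏ p ∈ Nat.primesBelow ⌈z⌉₊, (1 - g p) := by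
    have := inv_anti₀ (inv_pos.mpr hVpos) h2
    rwa [inv_inv] at this
  rw [← hVeq]
  refine le_trans (le_of_eq ?_) h3
  have e : (Real.log z / Real.log 2) ^ (2 * (D : ℝ)) = Real.log z ^ (2 * D) / Real.log 2 ^ (2 * D) := by
    rw [show (2 * (D : ℝ)) = ((2 * D : ℕ) : ℝ) by push_cast; ring, Real.rpow_natCast, div_pow]
  rw [e]
  field_simp

end IntervalClassSieve

end Literature.NumberTheory.Sieve
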